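import Summits.KontsevichZagierPeriods.Zeta5Search.Certificates.RayC1CoeffBound
import Summits.KontsevichZagierPeriods.Zeta5Search.Certificates.RayC1CentreAsymp
import Summits.KontsevichZagierPeriods.Zeta5Search.Certificates.RayC1PsiBound
import Summits.KontsevichZagierPeriods.Zeta5Search.Certificates.RecordRayCoeffAsymp
import HarnessLib

/-!
# ζ(5) search — certificates: the coefficient bound of the ray RayC1 in exponential form (cell `pub-zeta5`, P1 g11;
port of certifier 2's `Certificates/RecordRayCoeffAsymp.lean`)

HONEST FRAMING: systematic search; no irrationality claim unless certified.

OUR work (Summit side). The two-heights bound `RayC1CoeffBound.coeffW_C1E_abs_le` made asymptotic: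
`Mx ≤ exp(−256·n·log n + n·Ψ + 92·log(101n) + 40)` (`RayC1CentreAsymp`), `Ψ ≤ -508.031` (`RayC1PsiBound`), hence
**`coeffW_C1E_exp_le`**: `|W(natB (85n) (BC1E e n))| ≤ exp(−128·n·log n − 166.05·n + 48·log(101n) + 28)` (`e ≤ 1`, `n ≥ 1`;
`28π + Ψ/2 ≤ -166.05`), and the rate form `eventually_coeffW_c1_le_exp` for `b = bC1 n` and `b′ = bC1' n`.
-/

noncomputable section

open Finset Complex Filter Topology Real

namespace Summit.KontsevichZagierPeriods.Zeta5Search.RayC1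

open Summit.KontsevichZagierPeriods.Zeta5Search.DualSeries
open Summit.KontsevichZagierPeriods.Zeta5Search.DualSeriesBounds (natB)
open Summit.KontsevichZagierPeriods.Zeta5Search.WedgeDictionary (coeffW coeffU)
open Summit.KontsevichZagierPeriods.Zeta5Search.DualPF
open Summit.KontsevichZagierPeriods.Zeta5Search.RecordRay (eventually_log_linear_le)
open Summit.KontsevichZagierPeriods.Zeta5Search.RecordLine (qsq Dx Nm Dx_pos Nm_pos normSq_Rc_mul Gam)

/-! ### The centre value along the ray -/

/-- `NSq = Nm/D` at any point of a line of positive height (`e ≤ 1`, `n ≥ 1`). -/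
theorem NSqC1_eq_div {e n : ℕ} (he : e ≤ 1) (hn : 1 ≤ n) {Y : ℝ} (hY : 0 < Y) (x : ℝ) :
    NSqC1 e n Y x = Nm (85 * n) Y x / Dx (85 * n) (BC1E e n) Y x := by
  have h := normSq_Rc_mul (85 * n) (BC1E e n) (hreg_c1E he hn) (x := x) hY.ne'
  rw [eq_div_iff (Dx_pos (85 * n) (BC1E e n) hY x).ne']
  unfold NSqC1
  exact h

/-- **`Mx ≤ exp(asymptotic bound)`**: for `e ≤ 1`, `n ≥ 1`, `7n ≤ Y ≤ 7n+1`,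
`MxC1 e n Y ≤ exp(−256·n·log n + n·Ψ + 92·log(101n) + 40)`. -/
theorem MxC1_le_exp {e n : ℕ} (he : e ≤ 1) (hn : 1 ≤ n) {Y : ℝ} (hY1 : 7 * (n : ℝ) ≤ Y)
    (hY2 : Y ≤ 7 * n + 1) :
    MxC1 e n Y ≤ Real.exp (-256 * n * Real.log n + n * PsiC1 + 92 * Real.log (101 * n) + 40) := by
  have hnR : (1 : ℝ) ≤ n := by exact_mod_cast hn
  have hY : 0 < Y := by linarith
  have key : ∀ s : ℝ, 0 ≤ s → s ≤ 1 / 2 →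
      NSqC1 e n Y (-1 - (85 * (n : ℝ) / 2 + s)) ≤
        Real.exp (-256 * n * Real.log n + n * PsiC1 + 92 * Real.log (101 * n) + 40) := by
    intro s hs0 hs1
    have hpos : 0 < NSqC1 e n Y (-1 - (85 * (n : ℝ) / 2 + s)) := by
      rw [NSqC1_eq_div he hn hY]
      exact div_pos (Nm_pos _ hY _) (Dx_pos _ _ hY _)
    rw [← Real.exp_log hpos]
    apply Real.exp_le_exp.2
    rw [NSqC1_eq_div he hn hY]
    exact log_centre_C1_le he hn hY1 hY2 hs0 hs1
  have e1 : (-((((85 * n : ℕ) : ℝ) + 2) / 2) : ℝ) = -1 - (85 * (n : ℝ) / 2 + 0) := by push_cast; ring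
  have e2 : (-((((85 * n : ℕ) : ℝ) + 2) / 2) - 1 / 2 : ℝ) = -1 - (85 * (n : ℝ) / 2 + 1 / 2) := by push_cast; ring
  unfold MxC1
  rw [e2, e1]
  exact max_le (key 0 le_rfl (by norm_num)) (key (1 / 2) (by norm_num) le_rfl)

/-- **The certified constant**: `Ψ ≤ -508.031` (`RayC1PsiBound.psiC1_explicit_le`, unfolded). -/
theorem PsiC1_le : PsiC1 ≤ -(508031 / 1000 : ℝ) := by
  have h := psiC1_explicit_le
  unfold PsiC1 Gam tauC1
  simp only [sum_range_succ, sum_range_zero, βC1_values]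
  norm_num [βC1] at h ⊢
  linarith

/-- `S_e(Y) ≤ exp(−128·n·log n + n·Ψ/2 + 48·log(101n) + 21)` for `7n ≤ Y ≤ 7n+1`. -/
theorem SYC1_le_exp {e n : ℕ} (he : e ≤ 1) (hn : 1 ≤ n) {Y : ℝ} (hY1 : 7 * (n : ℝ) ≤ Y)
    (hY2 : Y ≤ 7 * n + 1) :
    SYC1 e n Y ≤ Real.exp (-128 * n * Real.log n + n * PsiC1 / 2 + 48 * Real.log (101 * n) + 21) := by
  have hnR : (1 : ℝ) ≤ n := by exact_mod_cast hn
  have hM := MxC1_le_exp he hn hY1 hY2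
  have hsqrt : Real.sqrt (MxC1 e n Y) ≤
      Real.exp ((-256 * n * Real.log n + n * PsiC1 + 92 * Real.log (101 * n) + 40) / 2) := by
    rw [Real.sqrt_le_left (by positivity), ← Real.exp_nat_mul]
    push_cast
    rw [show (2 : ℝ) * ((-256 * n * Real.log n + n * PsiC1 + 92 * Real.log (101 * n) + 40) / 2)
      = -256 * n * Real.log n + n * PsiC1 + 92 * Real.log (101 * n) + 40 by ring]
    exact hM
  have hpoly : ((42 : ℝ) * n + 3) * (42 * n + 4) ≤ Real.exp (2 * Real.log (101 * n)) := by
    rw [show (2 : ℝ) * Real.log (101 * n) = Real.log ((101 * n) ^ 2) by rw [Real.log_pow]; norm_num,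
      Real.exp_log (by positivity)]
    nlinarith
  have h32 : (3 : ℝ) / 2 ≤ Real.exp 1 := by
    have := Real.add_one_le_exp (1 : ℝ); linarith
  unfold SYC1
  calc 3 / 2 * (Real.sqrt (MxC1 e n Y) * ((42 * n + 3) * (42 * n + 4)))
      ≤ Real.exp 1 * (Real.exp ((-256 * n * Real.log n + n * PsiC1 + 92 * Real.log (101 * n) + 40) / 2)
          * Real.exp (2 * Real.log (101 * n))) := by
        apply mul_le_mul h32 _ (by positivity) (by positivity)
        exact mul_le_mul hsqrt hpoly (by positivity) (by positivity)
    _ = Real.exp (-128 * n * Real.log n + n * PsiC1 / 2 + 48 * Real.log (101 * n) + 21) := by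
        rw [← Real.exp_add, ← Real.exp_add]
        congr 1
        ring

/-- **SHARP COEFFICIENT DECAY on the ray RayC1 and its partner.** For `n ≥ 1`, `e ≤ 1`:
`|W(natB (85n) (BC1E e n))| ≤ exp(−128·n·log n − 166.05·n + 48·log(101n) + 28)` (`28π + Ψ/2 ≤ -166.05`). -/
theorem coeffW_C1E_exp_le {e n : ℕ} (he : e ≤ 1) (hn : 1 ≤ n) :
    |(coeffW (natB (85 * n) (BC1E e n)) : ℝ)| ≤
      Real.exp (-128 * n * Real.log n - 3321 / 20 * n + 48 * Real.log (101 * n) + 28) := by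
  have hnR : (1 : ℝ) ≤ n := by exact_mod_cast hn
  have hW := coeffW_C1E_abs_le he hn
  have hS1 := SYC1_le_exp he hn (Y := 7 * n + 1) (by linarith) le_rfl
  have hS2 := SYC1_le_exp he hn (Y := 7 * n) le_rfl (by linarith)
  set B : ℝ := -128 * n * Real.log n + n * PsiC1 / 2 + 48 * Real.log (101 * n) + 21 with hB
  have hpi := Real.pi_lt_d6
  have hpi0 := Real.pi_pos
  have hΨ := PsiC1_le
  have h1 : Real.exp (2 * π * (14 * n + 1)) ≤ Real.exp (28 * π * n + 2 * π) := by
    apply Real.exp_le_exp.2; nlinarith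
  have h2 : Real.exp (28 * π * n) ≤ Real.exp (28 * π * n + 2 * π) := by
    apply Real.exp_le_exp.2; nlinarith
  have hS0 : 0 ≤ SYC1 e n (7 * n + 1) := SYC1_nonneg _ _ _
  have hS0' : 0 ≤ SYC1 e n (7 * n) := SYC1_nonneg _ _ _
  have hsum : Real.exp (2 * π * (14 * n + 1)) * SYC1 e n (7 * n + 1) + Real.exp (28 * π * n) * SYC1 e n (7 * n)
      ≤ 2 * (Real.exp (28 * π * n + 2 * π) * Real.exp B) := by
    have a1 : Real.exp (2 * π * (14 * n + 1)) * SYC1 e n (7 * n + 1) ≤ Real.exp (28 * π * n + 2 * π) * Real.exp B :=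
      mul_le_mul h1 hS1 hS0 (by positivity)
    have a2 : Real.exp (28 * π * n) * SYC1 e n (7 * n) ≤ Real.exp (28 * π * n + 2 * π) * Real.exp B :=
      mul_le_mul h2 hS2 hS0' (by positivity)
    linarith
  have hfin : 2 * (Real.exp (28 * π * n + 2 * π) * Real.exp B) / 1000 ≤
      Real.exp (-128 * n * Real.log n - 3321 / 20 * n + 48 * Real.log (101 * n) + 28) := by
    have hlt : 2 * (Real.exp (28 * π * n + 2 * π) * Real.exp B) / 1000 ≤
        Real.exp (28 * π * n + 2 * π) * Real.exp B := by
      have hp : 0 ≤ Real.exp (28 * π * n + 2 * π) * Real.exp B := by positivity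
      linarith
    refine hlt.trans ?_
    rw [← Real.exp_add]
    apply Real.exp_le_exp.2
    rw [hB]
    have hn0 : (0 : ℝ) ≤ n := by linarith
    have hrate : (28 * π + PsiC1 / 2) * n ≤ -(3321 / 20) * n :=
      mul_le_mul_of_nonneg_right (by linarith) hn0
    linarith
  exact hW.trans (le_trans (by linarith [hsum]) hfin)

/-- **SHARP COEFFICIENT DECAY, by name**: for `n ≥ 1`, both `|W(bC1 n)|` and `|W(bC1' n)|` are
`≤ exp(−128·n·log n − 166.05·n + 48·log(101n) + 28)`. -/
theorem coeffW_c1_exp_le {n : ℕ} (hn : 1 ≤ n) :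
    |(coeffW (bC1 n) : ℝ)| ≤ Real.exp (-128 * n * Real.log n - 3321 / 20 * n + 48 * Real.log (101 * n) + 28) ∧
    |(coeffW (bC1' n) : ℝ)| ≤ Real.exp (-128 * n * Real.log n - 3321 / 20 * n + 48 * Real.log (101 * n) + 28) :=
  ⟨coeffW_C1E_exp_le (e := 0) (Nat.zero_le 1) hn, coeffW_C1E_exp_le (e := 1) le_rfl hn⟩

/-- **SHARP COEFFICIENT DECAY, rate form**: for every `ε > 0`, eventually
`|W(bC1 n)|, |W(bC1' n)| ≤ exp(−128·n·log n + (-166.05 + ε)·n)`. -/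
theorem eventually_coeffW_c1_le_exp {ε : ℝ} (hε : 0 < ε) :
    ∀ᶠ n : ℕ in atTop,
      |(coeffW (bC1 n) : ℝ)| ≤ Real.exp (-128 * n * Real.log n + (-(3321 / 20) + ε) * n) ∧
      |(coeffW (bC1' n) : ℝ)| ≤ Real.exp (-128 * n * Real.log n + (-(3321 / 20) + ε) * n) := by
  filter_upwards [eventually_ge_atTop 1,
    eventually_log_linear_le (a := 101) (b := 0) (by norm_num) le_rfl (show (0 : ℝ) < ε / 96 by positivity),
    tendsto_natCast_atTop_atTop.eventually_ge_atTop (56 / ε)] with n hn hlog hbig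
  have hb : (56 : ℝ) ≤ ε * n := by rwa [div_le_iff₀ hε, mul_comm] at hbig
  rw [add_zero] at hlog
  have hmono : Real.exp (-128 * n * Real.log n - 3321 / 20 * n + 48 * Real.log (101 * n) + 28) ≤
      Real.exp (-128 * n * Real.log n + (-(3321 / 20) + ε) * n) := by
    apply Real.exp_le_exp.2
    nlinarith
  obtain ⟨h0, h1⟩ := coeffW_c1_exp_le hn
  exact ⟨h0.trans hmono, h1.trans hmono⟩

end Summit.KontsevichZagierPeriods.Zeta5Search.RayC1
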